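import Literature.Analysis.Complex.LittleBernsteinSeries
import Mathlib.Analysis.Complex.CauchyIntegral
import Mathlib.Analysis.Analytic.Uniqueness
import Mathlib.Analysis.SpecialFunctions.Pow.Real
import HarnessLib

/-!
# The little Bernstein theorem, II: holomorphic extension to the right half-plane

Continuation of `Literature/Analysis/Complex/LittleBernsteinSeries.lean`.  For a smooth
`G : ℝ → ℝ` that is completely monotone on `(0,∞)` (`(-1)ⁿ G⁽ⁿ⁾ ≥ 0` there) the Taylor discs
`ball x₀ x₀`, `x₀ > 0`, tile the open right half-plane, and the Taylor series `P x₀` on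
them are restrictions of ONE holomorphic function:

* `cmTaylor_ofReal_eq` — `P x₀ t = G t` for ALL real `t ∈ (0, 2x₀)` (dyadic induction
  with the identity theorem from the interval `(x₀/2, 2x₀)`);
* `cmTaylor_eq_cmTaylor` — two Taylor series agree on the intersection of their discs;
* `exists_differentiableOn_halfPlane_of_cm` — **the little Bernstein theorem in the form the
  tree uses**: there is `F` holomorphic on `{Re z > 0}` with `F t = G t` for `t > 0` and the sharp
  bound `‖F z‖ ≤ G (Re z)` [cite: Widder1941, Ch. IV Thm. 3a; Ch. II §5 (Laplace transforms are
  holomorphic in the half-plane of convergence and dominated by their values on the real axis)].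

No measure theory is used: for completely monotone `G = 𝓛μ` this `F` is of course the Laplace
transform `∫ e^{-zλ} dμ(λ)`, but Bernstein's representation theorem is not needed to construct it.
-/

noncomputable section

open Set Filter Metric Finset
open scoped Topology BigOperators ContDiff Nat

namespace Literature.Analysis.Complex

variable {G : ℝ → ℝ}

/-! ### Identity-theorem glue -/

/-- Real points accumulate at a real point of `ℂ` from within the punctured neighbourhood: a
property holding at the real points of an open interval around `t₀` holds frequently near
`(t₀ : ℂ)` in `𝓝[≠] t₀`. [folklore] -/
theorem frequently_of_forall_real {p : ℂ → Prop} {a b t₀ : ℝ} (ht₀ : t₀ ∈ Ioo a b)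
    (h : ∀ t : ℝ, t ∈ Ioo a b → p t) : ∃ᶠ z in 𝓝[≠] (t₀ : ℂ), p z := by
  -- the sequence `t₀ + δ/(n+2)` with `δ = min (b - t₀) 1`
  set δ : ℝ := min (b - t₀) 1 with hδ
  have hδpos : 0 < δ := lt_min (by linarith [ht₀.2]) one_pos
  set u : ℕ → ℂ := fun n => ((t₀ + δ / (n + 2) : ℝ) : ℂ) with hu
  have hmem : ∀ n : ℕ, t₀ + δ / (n + 2) ∈ Ioo a b := by
    intro n
    have h1 : 0 < δ / (n + 2) := by positivity
    have h2 : δ / (n + 2) ≤ δ / 2 := by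
      apply div_le_div_of_nonneg_left hδpos.le (by norm_num) (by norm_cast; omega)
    have h3 : δ ≤ b - t₀ := min_le_left _ _
    constructor <;> linarith [ht₀.1]
  have htend : Tendsto u atTop (𝓝[≠] (t₀ : ℂ)) := by
    rw [tendsto_nhdsWithin_iff]
    constructor
    · have : Tendsto (fun n : ℕ => t₀ + δ / ((n : ℝ) + 2)) atTop (𝓝 (t₀ + 0)) := by
        refine tendsto_const_nhds.add ?_
        refine Tendsto.div_atTop tendsto_const_nhds ?_
        exact tendsto_natCast_atTop_atTop.atTop_add tendsto_const_nhds
      rw [add_zero] at this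
      exact (Complex.continuous_ofReal.tendsto _).comp this
    · refine Eventually.of_forall fun n => ?_
      rw [mem_compl_singleton_iff, hu, Ne, Complex.ofReal_inj]
      have : 0 < δ / ((n : ℝ) + 2) := by positivity
      linarith
  exact htend.frequently (Frequently.of_forall fun n => h _ (hmem n))

/-- In particular, two functions equal at the real points of an open interval around `t₀` agree
frequently near `(t₀ : ℂ)`. [folklore] -/
theorem frequently_eq_of_eqOn_real {f g : ℂ → ℂ} {a b t₀ : ℝ} (ht₀ : t₀ ∈ Ioo a b)
    (h : ∀ t : ℝ, t ∈ Ioo a b → f t = g t) : ∃ᶠ z in 𝓝[≠] (t₀ : ℂ), f z = g z :=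
  frequently_of_forall_real (p := fun z => f z = g z) ht₀ h

/-- Two functions holomorphic on a ball and equal at the real points of an open interval, one of
whose points lies in the ball, agree on the ball. [folklore] -/
theorem eqOn_ball_of_eqOn_real {f g : ℂ → ℂ} {c : ℂ} {r a b t₀ : ℝ}
    (hf : DifferentiableOn ℂ f (ball c r)) (hg : DifferentiableOn ℂ g (ball c r))
    (ht₀ : t₀ ∈ Ioo a b) (hball : (t₀ : ℂ) ∈ ball c r) (h : ∀ t : ℝ, t ∈ Ioo a b → f t = g t) :
    EqOn f g (ball c r) := by
  have hfa : AnalyticOnNhd ℂ f (ball c r) := hf.analyticOnNhd isOpen_ball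
  have hga : AnalyticOnNhd ℂ g (ball c r) := hg.analyticOnNhd isOpen_ball
  exact hfa.eqOn_of_preconnected_of_frequently_eq hga (convex_ball _ _).isPreconnected
    hball (frequently_eq_of_eqOn_real ht₀ h)

/-! ### The Taylor series represents `G` on the whole real trace of its disc -/

/-- For `0 < y ≤ x₀` the disc `ball y y` lies in `ball x₀ x₀`. [folklore] -/
theorem ball_subset_ball_of_le {y x₀ : ℝ} (hyx : y ≤ x₀) :
    ball ((y : ℝ) : ℂ) y ⊆ ball ((x₀ : ℝ) : ℂ) x₀ := by
  intro z hz
  rw [mem_ball, dist_eq_norm] at hz ⊢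
  calc ‖z - x₀‖ = ‖(z - y) - ((x₀ - y : ℝ) : ℂ)‖ := by push_cast; ring_nf
    _ ≤ ‖z - y‖ + ‖((x₀ - y : ℝ) : ℂ)‖ := norm_sub_le _ _
    _ < y + (x₀ - y) := by
        rw [Complex.norm_real, Real.norm_eq_abs, abs_of_nonneg (by linarith)]; linarith
    _ = x₀ := by ring

/-- **`P x₀ t = G t` for all real `t ∈ (0, 2x₀)`.**  Induction on `k`: equality on
`(x₀/2^{k+1}, 2x₀)`; the step compares `P x₀` with `P y`, `y = x₀/2^{k+1}`, on
`ball y y` (identity theorem; both equal `G` on `(y, 2y)`). [cite: Widder1941, Ch. IV Thm. 3a] -/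
theorem cmTaylor_ofReal_eq (hd : ContDiff ℝ ∞ G)
    (hcm : ∀ (n : ℕ) (t : ℝ), 0 < t → 0 ≤ (-1 : ℝ) ^ n * iteratedDeriv n G t) {P : ℝ → ℂ → ℂ}
    (hP : ∀ (x₀ : ℝ) (z : ℂ), P x₀ z = ∑' k, ((iteratedDeriv k G x₀ / k ! : ℝ) : ℂ) * (z - x₀) ^ k)
    {x₀ t : ℝ} (hx₀ : 0 < x₀) (ht : t ∈ Ioo 0 (2 * x₀)) : P x₀ t = G t := by
  -- dyadic induction
  have key : ∀ k : ℕ, ∀ s : ℝ, s ∈ Ioo (x₀ / 2 ^ (k + 1)) (2 * x₀) → P x₀ s = G s := by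
    intro k
    induction k with
    | zero =>
      intro s hs
      exact cmTaylor_ofReal_eq_of_mem_Ioo hd hcm hP hx₀ (by simpa using hs)
    | succ k ih =>
      intro s hs
      set y := x₀ / 2 ^ (k + 1) with hy
      have hypos : 0 < y := by positivity
      have hyx : y ≤ x₀ := by
        rw [hy]; exact div_le_self hx₀.le (one_le_pow₀ (by norm_num))
      have hy2 : x₀ / 2 ^ (k + 1 + 1) = y / 2 := by rw [hy, pow_succ]; ring
      rw [hy2] at hs
      by_cases hsy : y < s
      · exact ih s ⟨hsy, hs.2⟩
      · push Not at hsy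
        -- compare with the Taylor series at `y` on `ball y y`
        have hPd : DifferentiableOn ℂ (P x₀) (ball ((y : ℝ) : ℂ) y) :=
          (differentiableOn_cmTaylor hd hcm hP hx₀).mono (ball_subset_ball_of_le hyx)
        have hQd : DifferentiableOn ℂ (P y) (ball ((y : ℝ) : ℂ) y) :=
          differentiableOn_cmTaylor hd hcm hP hypos
        have hc : (3 * y / 2 : ℝ) ∈ Ioo y (2 * y) := ⟨by linarith, by linarith⟩
        have hcball : (((3 * y / 2 : ℝ)) : ℂ) ∈ ball ((y : ℝ) : ℂ) y := by
          rw [mem_ball, dist_eq_norm, ← Complex.ofReal_sub, Complex.norm_real, Real.norm_eq_abs,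
            abs_lt]
          constructor <;> linarith
        have hagree : ∀ u : ℝ, u ∈ Ioo y (2 * y) → P x₀ u = P y u := by
          intro u hu
          rw [ih u ⟨hu.1, by linarith [hu.2]⟩,
            cmTaylor_ofReal_eq_of_mem_Ioo hd hcm hP hypos ⟨by linarith [hu.1], hu.2⟩]
        have heq := eqOn_ball_of_eqOn_real hPd hQd hc hcball hagree
        have hsball : ((s : ℝ) : ℂ) ∈ ball ((y : ℝ) : ℂ) y := by
          rw [mem_ball, dist_eq_norm, ← Complex.ofReal_sub, Complex.norm_real, Real.norm_eq_abs,
            abs_lt]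
          constructor <;> linarith [hs.1]
        rw [heq hsball]
        exact cmTaylor_ofReal_eq_of_mem_Ioo hd hcm hP hypos ⟨hs.1, by linarith⟩
  -- choose `k` with `x₀ / 2^(k+1) < t`
  obtain ⟨k, hk⟩ : ∃ k : ℕ, x₀ / 2 ^ (k + 1) < t := by
    have h1 : Tendsto (fun k : ℕ => x₀ / 2 ^ (k + 1)) atTop (𝓝 0) := by
      have : Tendsto (fun k : ℕ => x₀ * (1 / 2) ^ (k + 1)) atTop (𝓝 (x₀ * 0)) :=
        (tendsto_pow_atTop_nhds_zero_of_lt_one (by norm_num) (by norm_num)).comp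
          (tendsto_add_atTop_nat 1) |>.const_mul x₀
      rw [mul_zero] at this
      refine this.congr fun k => ?_
      rw [one_div, inv_pow, div_eq_mul_inv]
    exact ((h1.eventually (gt_mem_nhds ht.1)).exists)
  exact key k t ⟨hk, ht.2⟩

/-- **Consistency of the Taylor discs**: for `x₀, x₁ > 0` the series `P x₀` and
`P x₁` agree on `ball x₀ x₀ ∩ ball x₁ x₁`. [cite: Widder1941, Ch. IV Thm. 3a] -/
theorem cmTaylor_eq_cmTaylor (hd : ContDiff ℝ ∞ G)
    (hcm : ∀ (n : ℕ) (t : ℝ), 0 < t → 0 ≤ (-1 : ℝ) ^ n * iteratedDeriv n G t) {P : ℝ → ℂ → ℂ}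
    (hP : ∀ (x₀ : ℝ) (z : ℂ), P x₀ z = ∑' k, ((iteratedDeriv k G x₀ / k ! : ℝ) : ℂ) * (z - x₀) ^ k)
    {x₀ x₁ : ℝ} (hx₀ : 0 < x₀) (hx₁ : 0 < x₁) {z : ℂ}
    (hz₀ : z ∈ ball ((x₀ : ℝ) : ℂ) x₀) (hz₁ : z ∈ ball ((x₁ : ℝ) : ℂ) x₁) :
    P x₀ z = P x₁ z := by
  -- reduce to `x₀ ≤ x₁`
  wlog hle : x₀ ≤ x₁ generalizing x₀ x₁
  · exact (this hx₁ hx₀ hz₁ hz₀ (le_of_not_ge hle)).symm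
  have hsub := ball_subset_ball_of_le hle
  have hPd : DifferentiableOn ℂ (P x₀) (ball ((x₀ : ℝ) : ℂ) x₀) :=
    differentiableOn_cmTaylor hd hcm hP hx₀
  have hQd : DifferentiableOn ℂ (P x₁) (ball ((x₀ : ℝ) : ℂ) x₀) :=
    (differentiableOn_cmTaylor hd hcm hP hx₁).mono hsub
  have hc : x₀ ∈ Ioo 0 (2 * x₀) := ⟨hx₀, by linarith⟩
  have hcball : ((x₀ : ℝ) : ℂ) ∈ ball ((x₀ : ℝ) : ℂ) x₀ := mem_ball_self hx₀
  have hagree : ∀ u : ℝ, u ∈ Ioo 0 (2 * x₀) → P x₀ u = P x₁ u := fun u hu => by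
    rw [cmTaylor_ofReal_eq hd hcm hP hx₀ hu, cmTaylor_ofReal_eq hd hcm hP hx₁ ⟨hu.1, by linarith [hu.2]⟩]
  exact eqOn_ball_of_eqOn_real hPd hQd hc hcball hagree hz₀

/-! ### The extension to the half-plane -/

/-- The canonical disc through `z`: with `x(z) = |z|²/Re z` one has `z ∈ ball x(z) x(z)` whenever
`Re z > 0`; more generally `z ∈ ball x x` for every `x ≥ |z|²/Re z`. [folklore] -/
theorem mem_ball_of_normSq_div_re_le {z : ℂ} (hz : 0 < z.re) {x : ℝ} (hx : Complex.normSq z / z.re ≤ x) :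
    z ∈ ball ((x : ℝ) : ℂ) x := by
  have hx0 : 0 < x := lt_of_lt_of_le (div_pos (Complex.normSq_pos.mpr (by
    rintro rfl; simp at hz)) hz) hx
  rw [mem_ball, dist_eq_norm]
  have hle : Complex.normSq z ≤ x * z.re := (div_le_iff₀ hz).mp hx
  have key : ‖z - x‖ ^ 2 < x ^ 2 := by
    rw [Complex.sq_norm, Complex.normSq_apply]
    simp only [Complex.sub_re, Complex.ofReal_re, Complex.sub_im, Complex.ofReal_im, sub_zero]
    rw [Complex.normSq_apply] at hle
    nlinarith
  exact (pow_lt_pow_iff_left₀ (norm_nonneg _) hx0.le two_ne_zero).mp key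

/-- **The little Bernstein theorem (half-plane form).**  A smooth function `G : ℝ → ℝ` with
`(-1)ⁿ G⁽ⁿ⁾(t) ≥ 0` for all `n` and all `t > 0` is the restriction to `(0,∞)` of a function `F`
holomorphic on the open right half-plane with `‖F z‖ ≤ G (Re z)` (Bernstein: absolutely /
completely monotone functions are analytic, the Taylor series at `x₀` converging on the disc of
radius `x₀`; the discs tile the half-plane and the series glue by the identity theorem; the bound is
`|∑ G⁽ᵏ⁾(x₀)(z-x₀)ᵏ/k!| ≤ G(x₀ - |z - x₀|) ↑ G(Re z)` as `x₀ → ∞`).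
[cite: Widder1941, Ch. IV Thm. 3a] -/
theorem exists_differentiableOn_halfPlane_of_cm (hd : ContDiff ℝ ∞ G)
    (hcm : ∀ (n : ℕ) (t : ℝ), 0 < t → 0 ≤ (-1 : ℝ) ^ n * iteratedDeriv n G t) :
    ∃ F : ℂ → ℂ, DifferentiableOn ℂ F {z : ℂ | 0 < z.re} ∧ (∀ t : ℝ, 0 < t → F t = G t) ∧
      ∀ z : ℂ, 0 < z.re → ‖F z‖ ≤ G z.re := by
  classical
  -- the Taylor series, as an explicit function with its defining equation
  set P : ℝ → ℂ → ℂ := fun x₀ z => ∑' k, ((iteratedDeriv k G x₀ / k ! : ℝ) : ℂ) * (z - x₀) ^ k with hPdef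
  have hP : ∀ (x₀ : ℝ) (z : ℂ), P x₀ z = ∑' k, ((iteratedDeriv k G x₀ / k ! : ℝ) : ℂ) * (z - x₀) ^ k :=
    fun _ _ => rfl
  set F : ℂ → ℂ := fun z => P (Complex.normSq z / z.re) z with hF
  -- `F` agrees with every admissible Taylor disc
  have hFeq : ∀ z : ℂ, 0 < z.re → ∀ x : ℝ, Complex.normSq z / z.re ≤ x → F z = P x z := by
    intro z hz x hx
    have hxz : 0 < Complex.normSq z / z.re :=
      div_pos (Complex.normSq_pos.mpr (by rintro rfl; simp at hz)) hz
    exact cmTaylor_eq_cmTaylor hd hcm hP hxz (hxz.trans_le hx) (mem_ball_of_normSq_div_re_le hz le_rfl)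
      (mem_ball_of_normSq_div_re_le hz hx)
  refine ⟨F, ?_, ?_, ?_⟩
  · -- holomorphy: near `z₀`, `F` is the Taylor series at `x₁ = |z₀|²/Re z₀ + 1`
    intro z₀ hz₀
    have hz₀' : 0 < z₀.re := hz₀
    set x₁ : ℝ := Complex.normSq z₀ / z₀.re + 1 with hx₁
    have hne : z₀ ≠ 0 := fun h => by rw [h, Complex.zero_re] at hz₀'; exact lt_irrefl _ hz₀'
    have hx₁pos : 0 < x₁ := by
      have := div_pos (Complex.normSq_pos.mpr hne) hz₀'
      rw [hx₁]; linarith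
    have hmem : z₀ ∈ ball ((x₁ : ℝ) : ℂ) x₁ := mem_ball_of_normSq_div_re_le hz₀' (by rw [hx₁]; linarith)
    -- on a neighbourhood of `z₀`: `Re z > 0`, `z ∈ ball x₁ x₁`, and `|z|²/Re z < x₁`
    have hcont : ContinuousAt (fun z : ℂ => Complex.normSq z / z.re) z₀ :=
      (Complex.continuous_normSq.continuousAt).div Complex.continuous_re.continuousAt hz₀'.ne'
    have hev : ∀ᶠ z in 𝓝 z₀, F z = P x₁ z := by
      have h1 : ∀ᶠ z in 𝓝 z₀, 0 < z.re := Complex.continuous_re.continuousAt.eventually (lt_mem_nhds hz₀')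
      have h2 : ∀ᶠ z in 𝓝 z₀, Complex.normSq z / z.re < x₁ :=
        hcont.eventually (gt_mem_nhds (by rw [hx₁]; linarith))
      filter_upwards [h1, h2] with z hz1 hz2
      exact hFeq z hz1 x₁ hz2.le
    have hdiff : DifferentiableAt ℂ (P x₁) z₀ :=
      (differentiableOn_cmTaylor hd hcm hP hx₁pos).differentiableAt (isOpen_ball.mem_nhds hmem)
    exact (hdiff.congr_of_eventuallyEq hev).differentiableWithinAt
  · -- real points
    intro t ht
    have htre : (0 : ℝ) < (t : ℂ).re := by simpa using ht
    have h1 : F t = P t t := by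
      refine hFeq t htre t (le_of_eq ?_)
      rw [Complex.normSq_ofReal, Complex.ofReal_re]; field_simp
    rw [h1]
    exact cmTaylor_ofReal_eq hd hcm hP ht ⟨ht, by linarith⟩
  · -- the bound `‖F z‖ ≤ G (Re z)`: use the discs at `x = n → ∞`
    intro z hz
    set a := z.re with ha
    set x₀ : ℝ := Complex.normSq z / z.re with hx₀
    -- for every `x ≥ x₀`: `‖F z‖ ≤ G (x - ‖z - x‖)`
    have hbound : ∀ x : ℝ, x₀ ≤ x → ‖F z‖ ≤ G (x - ‖z - x‖) := by
      intro x hx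
      rw [hFeq z hz x hx]
      have hzx : ‖z - x‖ < x := by simpa [mem_ball, dist_eq_norm] using mem_ball_of_normSq_div_re_le hz hx
      exact norm_cmTaylor_le hd hcm hP hzx
    -- `x - ‖z - x‖ → Re z` as `x → ∞`, squeezed between `a - b²/(2(x-a))` and `a`
    have hsq : ∀ x : ℝ, a < x → a - z.im ^ 2 / (2 * (x - a)) ≤ x - ‖z - x‖ ∧ x - ‖z - x‖ ≤ a := by
      intro x hxa
      have hnorm : ‖z - x‖ = Real.sqrt ((x - a) ^ 2 + z.im ^ 2) := by
        rw [Complex.norm_eq_sqrt_sq_add_sq]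
        simp [ha]; ring_nf
      have hu : 0 < x - a := by linarith
      constructor
      · -- `sqrt((x-a)² + b²) ≤ (x-a) + b²/(2(x-a))`
        have h1 : Real.sqrt ((x - a) ^ 2 + z.im ^ 2) ≤ (x - a) + z.im ^ 2 / (2 * (x - a)) := by
          rw [Real.sqrt_le_left (by positivity)]
          have : ((x - a) + z.im ^ 2 / (2 * (x - a))) ^ 2 =
              (x - a) ^ 2 + z.im ^ 2 + (z.im ^ 2 / (2 * (x - a))) ^ 2 := by
            field_simp; ring
          rw [this]; nlinarith [sq_nonneg (z.im ^ 2 / (2 * (x - a)))]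
        rw [hnorm]; linarith
      · have h2 : x - a ≤ Real.sqrt ((x - a) ^ 2 + z.im ^ 2) := by
          rw [Real.le_sqrt hu.le (by positivity)]; nlinarith [sq_nonneg z.im]
        rw [hnorm]; linarith
    have hlim : Tendsto (fun x : ℝ => x - ‖z - x‖) atTop (𝓝 a) := by
      have hlow : Tendsto (fun x : ℝ => a - z.im ^ 2 / (2 * (x - a))) atTop (𝓝 (a - 0)) := by
        refine tendsto_const_nhds.sub (Tendsto.div_atTop tendsto_const_nhds ?_)
        have h2 : Tendsto (fun x : ℝ => x + -a) atTop atTop := tendsto_atTop_add_const_right _ _ tendsto_id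
        exact (h2.const_mul_atTop (by norm_num : (0:ℝ) < 2)).congr fun x => by ring
      rw [sub_zero] at hlow
      refine tendsto_of_tendsto_of_tendsto_of_le_of_le' hlow tendsto_const_nhds ?_ ?_
      · filter_upwards [eventually_gt_atTop a] with x hx using (hsq x hx).1
      · filter_upwards [eventually_gt_atTop a] with x hx using (hsq x hx).2
    -- continuity of `G` at `a > 0` along this limit
    have hG : Tendsto (fun x : ℝ => G (x - ‖z - x‖)) atTop (𝓝 (G a)) :=
      (hd.continuous.tendsto a).comp hlim
    exact ge_of_tendsto hG (by
      filter_upwards [eventually_ge_atTop x₀] with x hx using hbound x hx)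

end Literature.Analysis.Complex
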